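import Summits.QuantumFields.BalabanUV.Beta.SymmetrisedStepJets
import Summits.QuantumFields.BalabanUV.Beta.CombChartResolventRules

/-!
# `BalabanUV.Beta.CombChartStepJets` — binder row D1, RULING R-D1-g35-1, brick P3: **THE CHART-(III′) LITERAL «JsB12CombSh»** — an1's (0.4) table record
# `SymTables` UNCHANGED, the slot families `SrecOf` ∕ `WrecOf` instantiated at the COMB-CHART resolvents `G′_j := GcombSh Lc j := coDressKAt ρ_c Lc (Gsym Lc j)`
# (in place of chart (II)'s `Gsym Lc j`), packaged as `JetData` with (St)(Wt) PROVED, the d = 4 names `JsB12CombSh0` (same pins as `JsB12Sym0`) and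
# `JsB12CombSh := dressAt ρ_c ∘ JsB12CombSh0` (the ROOTED COMB dressing `AxialDressingRootedLegs.dressAt`, in place of `dressSymAt`)
# (decl-by-decl sibling of `SymmetrisedStepJets` §1–§4; an3 g76 XAN262-AN3 §2 P3)

HONEST FRAMING (cell contract, verbatim): «discharging `BetaPertH` makes Bałaban's UV stability UNCONDITIONAL — a real constructive-QFT
result; it is NOT the continuum limit and NOT the Clay problem.»  HONEST DEPENDENCY: continuum YM on T⁴ ⇐ BetaPertH ∧ nine spine estimates (0/9 proved);
BetaPertH ⇐ (D1) ∧ (D4) ∧ CAP+tail; G-an2-4 gates asym, D1 and NE2/3/4.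
DERIVED cell leaf (β sub-cell, BINDER-OWNERS row D1 OWNER `b2b-balaban-beta-an2` gen 35).  THIS IS THE REPAIR TRACK's LITERAL, NOT (yet) the literal OF RECORD:
ROOT M′ p303989 over `JsB12Sym` (chart (II)) stays the record until the (III′) END lands (RULING R-D1-g35-1 (5), REFEREE #67's re-rooting protocol).  WHAT CHANGES vs
chart (II): ONLY the resolvent parameter of the slot recursion (`GcombSh` for `Gsym`) and the dressing functor (`dressAt ρ_c` for `dressSymAt ρ_c`); the five
tables, the six pins `(cE, cVH, cE₂) = (Lc⁴, −Lc⁸∕2, Lc⁸)`, free `cΛ`, `cB`, the Wilson table `(8N²)⁻¹ • wsym22 N` are those of `JsB12Sym0` VERBATIM.  WHY the change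
(owner's memo `HOME/b2b-balaban-beta-an2/gen35/R-D1-g35-1-CHART-IIIprime.v1.md` §1): in the ROOTED COMB slice `axEc ρ_c` the coordinate projector is DIAGONAL and commutes
with the product-chart contact generators (`DiagonalContact.comp_axEc_diagK_comm`), so the chart-conjugation defect words of the (N8) functional vanish and the
reflection binder hR closes by the gen-21 comb-closure pattern — with the relative inverse P2 `RelInvCombShiftedSpread.relInv_coDressKAt_Gsym_bhKStepSh` as its socket.
No statement of Bałaban's papers, no `[cite:]`, no `Prop` fact; data defs `GcombSh`, `ScombOf`, `SpureCombOf`, `WcombOf`, `jsCombOf`, `JsComb0Of`, `JsB12CombSh0`,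
`JsB12CombSh` ([our objects — NAMES over a displayed table record, asserting nothing]).  Discharges NO binder; NOT D1, NOT `BetaPertH`, NOT continuum, NOT Clay.
Provenance: β sub-cell, unit beta-an2 gen 35, 2026-08-21 (v1); over `SymmetrisedStepJets` (an2 gen 25), `CombChartResolventRules` §1 (the letters of `GcombSh`),
`SpineRooted` (`SrecOf`∕`SpureRecOf`∕`WrecOf` + letters), `AxialDressingRootedLegs.dressAt` BY NAME; no existing file touched.
-/

open Finset
open scoped BigOperators
open Literature.MathematicalPhysics.QuantumFieldTheory
open Literature.MathematicalPhysics.QuantumFieldTheory.Balaban1983to89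
open Literature.MathematicalPhysics.QuantumFieldTheory.Balaban1983to89.Beta
open ExpKernelCalculus (MKer Decays BiLoc VertexFamily VertexFamily₂ shiftK)
open OneStepResolventKernel (Fib LocStencil JetData)
open OneStepKernelFamily (KInvStep)
open AffineAveraging (box toSite)
open AveragingContoursRooted (ctr ctrOff ctrOff_mem_box)
open BalabanCompositeJets (LocStencil₂)
open SecondOrderResponse (LocStencilFM)
open BalabanStepJets (locStencil_mono vertexFamily₂_mono)
open WilsonVertex2Sym (wsym22)
open Summit.QuantumFields.BalabanUV.Beta.TameKernelCalculus
open Summit.QuantumFields.BalabanUV.Beta.AxialDressingRooted (one_le_of_neZero coDressKAt dressAt)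
open Summit.QuantumFields.BalabanUV.Beta.WardLocusRecursive (SrecOf)
open Summit.QuantumFields.BalabanUV.Beta.SpineRooted (SpureRecOf locStencil_SrecOf locStencil_SpureRecOf SrecOf_translate SpureRecOf_translate
  WrecOf vertexFamily₂_WrecOf' WrecOf_translate)
open Summit.QuantumFields.BalabanUV.Beta.SymmetrisedStepJets (SymTables Gsym)
open Summit.QuantumFields.BalabanUV.Beta.CombChartResolventRules (decays_coDressKAt_Gsym shiftK_coDressKAt_Gsym)

namespace Summit.QuantumFields.BalabanUV.Beta.CombChartStepJets

noncomputable section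

variable {d : ℕ}

/-! ## §1 The comb-chart resolvents `G′_j` -/

section Resolvents

variable (Lc : ℕ) [NeZero Lc]

/-- [our object] **THE COMB-CHART RESOLVENTS** `GcombSh Lc j := coDressKAt ρ_c Lc (Gsym Lc j)` — the chart-(II) resolvent re-dressed by the ROOTED comb dressing at the
centred root (an3 XAN262-AN3 §1; letters in `CombChartResolventRules` §1; relative inverse of the legged spread on the comb slice = P2). -/
def GcombSh : ℕ → MKer (d + 1) (Fib d) := fun j => coDressKAt (ctr (d + 1) Lc) Lc (Gsym (d := d) Lc j)

/-- [folklore] `GcombSh` unfolded. -/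
theorem GcombSh_apply (j : ℕ) : GcombSh (d := d) Lc j = coDressKAt (ctr (d + 1) Lc) Lc (Gsym (d := d) Lc j) := rfl

/-- [folklore] (DG′) every `G′_j` decays (`CombChartResolventRules.decays_coDressKAt_Gsym`). -/
theorem decays_GcombSh : ∀ j : ℕ, ∃ δ C : ℝ, 0 < δ ∧ 0 ≤ C ∧ Decays (GcombSh (d := d) Lc j) C δ := fun j =>
  decays_coDressKAt_Gsym Lc j

/-- [folklore] (TG′) every `G′_j` is `Lc`-block-translation invariant (`CombChartResolventRules.shiftK_coDressKAt_Gsym`). -/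
theorem shiftK_GcombSh : ∀ (j : ℕ) (t : Fin (d + 1) → ℤ), shiftK (-((Lc : ℤ) • t)) (GcombSh (d := d) Lc j) = GcombSh (d := d) Lc j := fun j t =>
  shiftK_coDressKAt_Gsym Lc j t

end Resolvents

/-! ## §2 The slot families at the record, comb chart -/

section Families

variable {Lc : ℕ} [NeZero Lc] (tabs : SymTables d Lc) (cE cVH cΛ cE₂ cB : ℝ) (T : Fin 4 → Fin 4 → Fin 4 → Fin 4 → ℝ)

/-- [our object] The first-order tables of the comb-chart literal: `SrecOf V H GcombSh`. -/
def ScombOf : ℕ → Fin (d + 1) → (Fin (d + 1) → ℤ) → MKer (d + 1) (Fib d) := SrecOf d Lc tabs.V tabs.H (GcombSh Lc) cE cVH cΛ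

/-- [our object] Their pure (Λ-free) parts: `SpureRecOf V H GcombSh`. -/
def SpureCombOf : ℕ → Fin (d + 1) → (Fin (d + 1) → ℤ) → MKer (d + 1) (Fib d) := SpureRecOf d Lc tabs.V tabs.H (GcombSh Lc) cE cVH cΛ

/-- [our object] The second-order tables of the comb-chart literal: `WrecOf GcombSh SpureCombOf M … vh₂S mixFF`. -/
def WcombOf : ℕ → Fin (d + 1) → (Fin (d + 1) → ℤ) → Fin (d + 1) → (Fin (d + 1) → ℤ) → MKer (d + 1) (Fib d) :=
  WrecOf d Lc (GcombSh Lc) (SpureCombOf tabs cE cVH cΛ) tabs.M cE₂ cB T tabs.vh₂S tabs.mixFF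

/-- [folklore] `ScombOf` unfolded. -/
theorem ScombOf_eq : ScombOf tabs cE cVH cΛ = SrecOf d Lc tabs.V tabs.H (GcombSh Lc) cE cVH cΛ := rfl

/-- [folklore] `SpureCombOf` unfolded. -/
theorem SpureCombOf_eq : SpureCombOf tabs cE cVH cΛ = SpureRecOf d Lc tabs.V tabs.H (GcombSh Lc) cE cVH cΛ := rfl

/-- [folklore] `WcombOf` unfolded. -/
theorem WcombOf_eq : WcombOf tabs cE cVH cΛ cE₂ cB T =
    WrecOf d Lc (GcombSh Lc) (SpureRecOf d Lc tabs.V tabs.H (GcombSh Lc) cE cVH cΛ) tabs.M cE₂ cB T tabs.vh₂S tabs.mixFF := rfl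

/-- [folklore] (LS) every first-order member is a localised stencil family. -/
theorem locStencil_ScombOf : ∀ j : ℕ, ∃ Cs δ : ℝ, 0 < δ ∧ LocStencil (ScombOf tabs cE cVH cΛ j) Cs δ :=
  locStencil_SrecOf (one_le_of_neZero Lc) tabs.hV tabs.hH (decays_GcombSh Lc) cE cVH cΛ

/-- [folklore] (LS♭) every pure member is a localised stencil family. -/
theorem locStencil_SpureCombOf : ∀ j : ℕ, ∃ Cs δ : ℝ, 0 < δ ∧ LocStencil (SpureCombOf tabs cE cVH cΛ j) Cs δ :=
  locStencil_SpureRecOf (one_le_of_neZero Lc) tabs.hV tabs.hH (decays_GcombSh Lc) cE cVH cΛ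

/-- [folklore] (LW) every second-order member is a second-order vertex family. -/
theorem vertexFamily₂_WcombOf (j : ℕ) : ∃ Cw δw : ℝ, 0 < δw ∧ VertexFamily₂ (WcombOf tabs cE cVH cΛ cE₂ cB T j) Lc Cw δw :=
  vertexFamily₂_WrecOf' cE₂ cB T tabs.vh₂S tabs.mixFF (one_le_of_neZero Lc) (decays_GcombSh Lc) (locStencil_SpureCombOf tabs cE cVH cΛ) tabs.hM
    tabs.hB tabs.hmix j

/-- [folklore] (St) of the first-order members. -/
theorem ScombOf_translate (j : ℕ) (κ' : Fin (d + 1)) (u t : Fin (d + 1) → ℤ) :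
    ScombOf tabs cE cVH cΛ j κ' (u + (Lc : ℤ) • t) = shiftK (-((Lc : ℤ) • t)) (ScombOf tabs cE cVH cΛ j κ' u) :=
  SrecOf_translate tabs.hVt tabs.hHt (shiftK_GcombSh Lc) cE cVH cΛ j κ' u t

/-- [folklore] (St♭) of the pure members. -/
theorem SpureCombOf_translate (j : ℕ) (κ' : Fin (d + 1)) (u t : Fin (d + 1) → ℤ) :
    SpureCombOf tabs cE cVH cΛ j κ' (u + (Lc : ℤ) • t) = shiftK (-((Lc : ℤ) • t)) (SpureCombOf tabs cE cVH cΛ j κ' u) :=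
  SpureRecOf_translate tabs.hVt tabs.hHt (shiftK_GcombSh Lc) cE cVH cΛ j κ' u t

/-- [folklore] (Wt) of the second-order members. -/
theorem WcombOf_translate (j : ℕ) (μ : Fin (d + 1)) (y : Fin (d + 1) → ℤ) (ν : Fin (d + 1)) (y' t : Fin (d + 1) → ℤ) :
    WcombOf tabs cE cVH cΛ cE₂ cB T j μ (y + t) ν (y' + t) = shiftK (-((Lc : ℤ) • t)) (WcombOf tabs cE cVH cΛ cE₂ cB T j μ y ν y') :=
  WrecOf_translate cE₂ cB T (shiftK_GcombSh Lc) (SpureCombOf_translate tabs cE cVH cΛ) tabs.hMt tabs.hBt tabs.hmixt j μ y ν y' t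

end Families

/-! ## §3 The undressed comb-chart family as jet data; (St)(Wt) -/

section Package

variable {Lc : ℕ} [NeZero Lc] (tabs : SymTables d Lc) (cE cVH cΛ cE₂ cB : ℝ) (T : Fin 4 → Fin 4 → Fin 4 → Fin 4 → ℝ)

/-- [our object] **THE STEP-`j` JET DATUM OF THE COMB-CHART LITERAL**: `(ScombOf … j, WcombOf … j)` with the packaged localisation constants and the common radius. -/
def jsCombOf (j : ℕ) : JetData d Lc :=
  have hS := locStencil_ScombOf tabs cE cVH cΛ j
  have hW := vertexFamily₂_WcombOf tabs cE cVH cΛ cE₂ cB T j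
  have hδS : 0 < hS.choose_spec.choose := hS.choose_spec.choose_spec.1
  have hδW : 0 < hW.choose_spec.choose := hW.choose_spec.choose_spec.1
  have hloc : LocStencil (ScombOf tabs cE cVH cΛ j) hS.choose hS.choose_spec.choose := hS.choose_spec.choose_spec.2
  have hloc₂ : VertexFamily₂ (WcombOf tabs cE cVH cΛ cE₂ cB T j) Lc hW.choose hW.choose_spec.choose := hW.choose_spec.choose_spec.2
  { S := ScombOf tabs cE cVH cΛ j
    W := WcombOf tabs cE cVH cΛ cE₂ cB T j
    Cs := hS.choose
    Cw := hW.choose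
    δ := min hS.choose_spec.choose hW.choose_spec.choose
    δ_pos := lt_min hδS hδW
    loc := locStencil_mono hloc ((hloc 0 0).nonneg (Sum.inl 0)) (min_le_left _ _)
    loc₂ := vertexFamily₂_mono hloc₂ ((hloc₂ 0 0 0 0).nonneg (Sum.inl 0)) (min_le_right _ _) }

/-- [our object] **THE UNDRESSED COMB-CHART (0.4) FAMILY OVER ITS TABLE RECORD**: `j ↦ jsCombOf … j`. -/
def JsComb0Of : ℕ → JetData d Lc := fun j => jsCombOf tabs cE cVH cΛ cE₂ cB T j

/-- [folklore] The first-order table of member `j`. -/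
@[simp] theorem JsComb0Of_S (j : ℕ) : (JsComb0Of tabs cE cVH cΛ cE₂ cB T j).S = ScombOf tabs cE cVH cΛ j := rfl

/-- [folklore] The second-order table of member `j`. -/
@[simp] theorem JsComb0Of_W (j : ℕ) : (JsComb0Of tabs cE cVH cΛ cE₂ cB T j).W = WcombOf tabs cE cVH cΛ cE₂ cB T j := rfl

/-- [folklore] **(St) FOR THE COMB-CHART LITERAL** — a THEOREM from the record's (TV)(TH) and `shiftK_GcombSh`. -/
theorem JsComb0Of_S_translate (j : ℕ) (κ' : Fin (d + 1)) (u t : Fin (d + 1) → ℤ) :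
    (JsComb0Of tabs cE cVH cΛ cE₂ cB T j).S κ' (u + (Lc : ℤ) • t) = shiftK (-((Lc : ℤ) • t)) ((JsComb0Of tabs cE cVH cΛ cE₂ cB T j).S κ' u) := by
  rw [JsComb0Of_S]
  exact ScombOf_translate tabs cE cVH cΛ j κ' u t

/-- [folklore] **(Wt) FOR THE COMB-CHART LITERAL** — a THEOREM from the record's (TV)(TH)(TM)(TB)(Tmix) and `shiftK_GcombSh`. -/
theorem JsComb0Of_W_translate (j : ℕ) (μ : Fin (d + 1)) (y : Fin (d + 1) → ℤ) (ν : Fin (d + 1)) (y' t : Fin (d + 1) → ℤ) :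
    (JsComb0Of tabs cE cVH cΛ cE₂ cB T j).W μ (y + t) ν (y' + t) = shiftK (-((Lc : ℤ) • t)) ((JsComb0Of tabs cE cVH cΛ cE₂ cB T j).W μ y ν y') := by
  rw [JsComb0Of_W]
  exact WcombOf_translate tabs cE cVH cΛ cE₂ cB T j μ y ν y' t

end Package

/-! ## §4 d + 1 = 4: the names `JsB12CombSh0`, `JsB12CombSh` -/

section FourD

variable {Lc : ℕ} [NeZero Lc]

/-- [our object — THE CHART-(III′) LITERAL of BINDER row D1's repair track, undressed] **`JsB12CombSh⁰`**: `JsComb0Of tabs` at the pins of `JsB12Sym0`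
(`(cE, cVH, cE₂) = (Lc⁴, −Lc⁸∕2, Lc⁸)`, Wilson table `(8N²)⁻¹ • wsym22 N`), free `cΛ`, `cB`.  A NAME over a displayed table record, asserting nothing. -/
def JsB12CombSh0 (_hLc : Odd Lc) (N : ℕ) (tabs : SymTables 3 Lc) (cΛ cB : ℝ) : ℕ → JetData 3 Lc :=
  JsComb0Of tabs ((Lc : ℝ) ^ 4) (-((Lc : ℝ) ^ 8 / 2)) cΛ ((Lc : ℝ) ^ 8) cB ((8 * (N : ℝ) ^ 2)⁻¹ • wsym22 N)

/-- [folklore] `JsB12CombSh⁰` unfolded (`rfl`). -/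
theorem JsB12CombSh0_eq (hLc : Odd Lc) (N : ℕ) (tabs : SymTables 3 Lc) (cΛ cB : ℝ) :
    JsB12CombSh0 hLc N tabs cΛ cB = JsComb0Of tabs ((Lc : ℝ) ^ 4) (-((Lc : ℝ) ^ 8 / 2)) cΛ ((Lc : ℝ) ^ 8) cB ((8 * (N : ℝ) ^ 2)⁻¹ • wsym22 N) := rfl

/-- [folklore] (St) for `JsB12CombSh⁰`. -/
theorem JsB12CombSh0_S_translate (hLc : Odd Lc) (N : ℕ) (tabs : SymTables 3 Lc) (cΛ cB : ℝ) (j : ℕ) (κ' : Fin 4) (u t : Fin 4 → ℤ) :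
    (JsB12CombSh0 hLc N tabs cΛ cB j).S κ' (u + (Lc : ℤ) • t) = shiftK (-((Lc : ℤ) • t)) ((JsB12CombSh0 hLc N tabs cΛ cB j).S κ' u) :=
  JsComb0Of_S_translate tabs _ _ _ _ _ _ j κ' u t

/-- [folklore] (Wt) for `JsB12CombSh⁰`. -/
theorem JsB12CombSh0_W_translate (hLc : Odd Lc) (N : ℕ) (tabs : SymTables 3 Lc) (cΛ cB : ℝ) (j : ℕ) (μ : Fin 4) (y : Fin 4 → ℤ) (ν : Fin 4)
    (y' t : Fin 4 → ℤ) :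
    (JsB12CombSh0 hLc N tabs cΛ cB j).W μ (y + t) ν (y' + t) = shiftK (-((Lc : ℤ) • t)) ((JsB12CombSh0 hLc N tabs cΛ cB j).W μ y ν y') :=
  JsComb0Of_W_translate tabs _ _ _ _ _ _ j μ y ν y' t

/-- [our object — THE CHART-(III′) LITERAL, dressed] **`JsB12CombSh := dressAt ρ_c ∘ JsB12CombSh⁰`** (the ROOTED COMB dressing at the centred root). -/
def JsB12CombSh (hLc : Odd Lc) (N : ℕ) (tabs : SymTables 3 Lc) (cΛ cB : ℝ) : ℕ → JetData 3 Lc := fun j =>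
  dressAt (ctrOff_mem_box (d := 4) (one_le_of_neZero Lc)) (JsB12CombSh0 hLc N tabs cΛ cB j)

/-- [folklore] `JsB12CombSh` is `dressAt ρ_c ∘ JsB12CombSh⁰` (`rfl`). -/
theorem JsB12CombSh_apply (hLc : Odd Lc) (N : ℕ) (tabs : SymTables 3 Lc) (cΛ cB : ℝ) (j : ℕ) :
    JsB12CombSh hLc N tabs cΛ cB j = dressAt (ctrOff_mem_box (d := 4) (one_le_of_neZero Lc)) (JsB12CombSh0 hLc N tabs cΛ cB j) := rfl

end FourD

end

end Summit.QuantumFields.BalabanUV.Beta.CombChartStepJets
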